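import Literature.Analysis.FluidPDE.SwirlMaximumPrinciple
import Literature.Analysis.FluidPDE.DriftHeatLocalComparison
import HarnessLib

/-!
# Stub `stub_weakMaxPrincipleLocal` of the line `absorbing-axis-swirl-extinction`
# (crux `AxisymEndLiouville`, stmt-NavierStokesRegularity-14061, thesis `SymmetryModuliCount`)

The weak parabolic maximum principle of the tree
(`Literature.Analysis.FluidPDE.weak_max_principle`; Lieberman 1996, Ch. II, Lemma 2.1 with
Lemma 2.3, abstract form) on `[T₁, T₂] × K`, `K ⊆ ℝ³` compact, `U ⊆ K` open, with ONE
change: the slice regularity `C²` of `w t` is required only ON the open set `U`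
(`ContDiffOn ℝ 2 (w t) U`) instead of on the whole space — the comparison function of the
line is not `C²` across the rotation axis, which lies in `K ∖ U`.

The proof is the tree proof verbatim: a positive value of `w` forces a positive maximum of
`w − θ(t − T₁)` (small `θ > 0`) on the compact `[T₁, T₂] × K`, off the parabolic boundary,
at a point `(t', x')` with `T₁ < t'`, `x' ∈ U`; there `∇(w t')(x') = 0`
(`IsLocalMax.fderiv_eq_zero`) and `Δ(w t')(x') ≤ 0` — the only place where slice regularity
enters, through the tree's localised second-order condition
`laplacian_nonpos_of_isLocalMax_of_contDiffOn` (`DriftHeatLocalComparison`: bump-function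
localisation of `IsLocalMax.laplacian_nonpos`, needs `C²` only on an open set containing
`x'`) — while the left time derivative of `s ↦ w s x' − θ(s − T₁)` at its maximum `t'` over
`[T₁, t']` is `≥ 0` (`IsLocalMaxOn.hasFDerivWithinAt_nonpos` against the tangent direction
`T₁ − t' < 0`), i.e. `wₜ t' x' ≥ θ > 0`, contradicting the sub-solution implication
`∇w = 0 ∧ Δw ≤ 0 ⟹ wₜ ≤ 0`.

## References

* G. M. Lieberman, *Second order parabolic differential equations*, World Scientific 1996,
  Ch. II, Lemma 2.1, Lemma 2.3. [`Lieberman1996`]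
-/

noncomputable section

-- the summit and its single problem share the name (D-0017 nested layout)
set_option linter.dupNamespace false

open Set Function Filter Topology MeasureTheory InnerProductSpace Metric
open scoped RealInnerProductSpace Laplacian ContDiff NNReal

namespace Summit.NavierStokesRegularity.NavierStokesRegularity.Theorems.AxisymEndLiouville.AbsorbingAxisSwirlExtinction

open Literature.Analysis.FluidPDE

/-- `ℝ³` (local notation, as in the lead's skeleton, so that the registered stub signature is
matched verbatim). -/
local notation "E3" => EuclideanSpace ℝ (Fin 3)

/-- **Weak parabolic maximum principle, slices `C²` only on `U`** (Lieberman 1996, Ch. II,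
Lemma 2.1 with Lemma 2.3, abstract form; the tree's `weak_max_principle` with localised
slice regularity).  Let `K ⊆ ℝ³` be compact, `U ⊆ K` open, and let `w : ℝ → ℝ³ → ℝ` be
jointly continuous on `[T₁, T₂] × K`, with slices `w t` of class `C²` on `U` for
`t ∈ (T₁, T₂]` and a left time derivative `wₜ t x` (within `[T₁, t]`) at the points of
`(T₁, T₂] × U`.  Assume the sub-solution implication
`∇(w t)(x) = 0 → Δ(w t)(x) ≤ 0 → wₜ t x ≤ 0` on `(T₁, T₂] × U` and `w ≤ 0` on the parabolic
boundary: at `t = T₁` on `K`, and on `[T₁, T₂] × (K ∖ U)`.  Then `w ≤ 0` on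
`[T₁, T₂] × K`. -/
theorem stub_weakMaxPrincipleLocal (K U : Set E3) (hK : IsCompact K) (hU : IsOpen U) (hUK : U ⊆ K)
    (T₁ T₂ : ℝ) (w wₜ : ℝ → E3 → ℝ)
    (hc : ContinuousOn (uncurry w) (Icc T₁ T₂ ×ˢ K))
    (h2 : ∀ t ∈ Ioc T₁ T₂, ContDiffOn ℝ 2 (w t) U)
    (ht : ∀ t ∈ Ioc T₁ T₂, ∀ x ∈ U, HasDerivWithinAt (fun s => w s x) (wₜ t x) (Icc T₁ t) t)
    (hsub : ∀ t ∈ Ioc T₁ T₂, ∀ x ∈ U, fderiv ℝ (w t) x = 0 → (Δ (w t)) x ≤ 0 → wₜ t x ≤ 0)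
    (hbot : ∀ x ∈ K, w T₁ x ≤ 0)
    (hlat : ∀ t ∈ Icc T₁ T₂, ∀ x ∈ K \ U, w t x ≤ 0) :
    ∀ t ∈ Icc T₁ T₂, ∀ x ∈ K, w t x ≤ 0 := by
  -- adapted from `Literature.Analysis.FluidPDE.weak_max_principle` (SwirlMaximumPrinciple):
  -- the single change is the second-order condition at the interior maximum point, taken from
  -- `laplacian_nonpos_of_isLocalMax_of_contDiffOn` instead of `IsLocalMax.laplacian_nonpos`.
  by_contra H
  push Not at H
  obtain ⟨t₀, ht₀, x₀, hx₀, hpos⟩ := H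
  -- the perturbation `θ (t - T₁)`
  set δ : ℝ := w t₀ x₀ with hδ
  set θ : ℝ := δ / (2 * (T₂ - T₁ + 1)) with hθ
  have hT : T₁ ≤ T₂ := ht₀.1.trans ht₀.2
  have hθpos : 0 < θ := div_pos hpos (by linarith)
  have hθδ : θ * (t₀ - T₁) < δ := by
    have h1 : θ * (t₀ - T₁) ≤ θ * (T₂ - T₁ + 1) :=
      mul_le_mul_of_nonneg_left (by linarith [ht₀.2]) hθpos.le
    have h2 : θ * (T₂ - T₁ + 1) = δ / 2 := by
      rw [hθ, div_mul_eq_mul_div, mul_div_mul_right _ _ (by linarith : (T₂ - T₁ + 1) ≠ 0)]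
    linarith
  -- a maximum point of `g = w - θ (t - T₁)` on the compact `[T₁, T₂] × K`
  set S : Set (ℝ × E3) := Icc T₁ T₂ ×ˢ K with hS
  have hSc : IsCompact S := isCompact_Icc.prod hK
  set g : ℝ × E3 → ℝ := fun p => w p.1 p.2 - θ * (p.1 - T₁) with hg
  have hgc : ContinuousOn g S := by
    have h3 : Continuous fun p : ℝ × E3 => θ * (p.1 - T₁) := by fun_prop
    exact hc.sub h3.continuousOn
  obtain ⟨⟨t', x'⟩, ⟨ht', hx'⟩, hmax⟩ := hSc.exists_isMaxOn ⟨(t₀, x₀), ht₀, hx₀⟩ hgc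
  simp only at ht' hx'
  have hmax' : ∀ t ∈ Icc T₁ T₂, ∀ x ∈ K, w t x - θ * (t - T₁) ≤ w t' x' - θ * (t' - T₁) :=
    fun t ht x hx => hmax (show (t, x) ∈ S from ⟨ht, hx⟩)
  have hgpos : 0 < w t' x' - θ * (t' - T₁) := by
    have := hmax' t₀ ht₀ x₀ hx₀
    linarith
  have hwpos : 0 < w t' x' := by
    have : 0 ≤ θ * (t' - T₁) := mul_nonneg hθpos.le (by linarith [ht'.1])
    linarith
  -- the maximum point is off the parabolic boundary
  have ht'1 : T₁ < t' := by
    rcases eq_or_lt_of_le ht'.1 with h | h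
    · exfalso
      have hb := hbot x' hx'
      rw [h] at hb
      linarith
    · exact h
  have hx'U : x' ∈ U := by
    by_contra hxU
    have hl := hlat t' ht' x' ⟨hx', hxU⟩
    linarith
  have ht'I : t' ∈ Ioc T₁ T₂ := ⟨ht'1, ht'.2⟩
  -- first- and second-order conditions in space (regularity is used only here, on `U ∋ x'`)
  have hloc : IsLocalMax (w t') x' := by
    filter_upwards [hU.mem_nhds hx'U] with x hx
    have := hmax' t' ht' x (hUK hx)
    linarith
  have hgrad : fderiv ℝ (w t') x' = 0 := hloc.fderiv_eq_zero
  have hlap : (Δ (w t')) x' ≤ 0 :=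
    laplacian_nonpos_of_isLocalMax_of_contDiffOn hU hx'U (h2 t' ht'I) hloc
  have hwt : wₜ t' x' ≤ 0 := hsub t' ht'I x' hx'U hgrad hlap
  -- the left time derivative of `g (·, x')` at `t'` is nonnegative
  have hderiv : HasDerivWithinAt (fun s => w s x' - θ * (s - T₁)) (wₜ t' x' - θ) (Icc T₁ t') t' := by
    have h1 := ht t' ht'I x' hx'U
    have h2 : HasDerivWithinAt (fun s : ℝ => θ * (s - T₁)) θ (Icc T₁ t') t' := by
      have := ((hasDerivAt_id t').sub_const T₁).const_mul θ
      simpa using this.hasDerivWithinAt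
    exact h1.sub h2
  have hmaxOn : IsLocalMaxOn (fun s => w s x' - θ * (s - T₁)) (Icc T₁ t') t' :=
    Filter.eventually_of_mem self_mem_nhdsWithin fun s hs =>
      hmax' s ⟨hs.1, hs.2.trans ht'.2⟩ x' hx'
  have hcone : T₁ - t' ∈ posTangentConeAt (Icc T₁ t') t' := by
    have hseg : segment ℝ t' T₁ ⊆ Icc T₁ t' := by
      rw [segment_symm, segment_eq_Icc ht'1.le]
    exact sub_mem_posTangentConeAt_of_segment_subset hseg
  have key : (T₁ - t') * (wₜ t' x' - θ) ≤ 0 := by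
    simpa using hmaxOn.hasFDerivWithinAt_nonpos hderiv.hasFDerivWithinAt hcone
  -- `(T₁ - t') (wₜ - θ) ≤ 0` with `T₁ - t' < 0` forces `wₜ ≥ θ > 0`
  have hneg : T₁ - t' < 0 := by linarith
  have : 0 ≤ wₜ t' x' - θ := by
    by_contra hcon
    push Not at hcon
    have := mul_pos_of_neg_of_neg hneg hcon
    linarith
  linarith

end Summit.NavierStokesRegularity.NavierStokesRegularity.Theorems.AxisymEndLiouville.AbsorbingAxisSwirlExtinction
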